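import Summits.NavierStokesRegularity.NavierStokesRegularity.Theorems.PalasekTowerBreakdownEpisodeBaseTMechanismFreeRun

/-!
# Line `straindoor` — skeleton v5 for the crux `EpisodeBaseT` (stmt-NavierStokesRegularity-20303)

LEAD prover ns-palasek-20303-p1 (g1 = prover-ns-palasek-20303-p1-g1-0), 2026-08-27; successor of g0's v4b
(evidence 20303 #31, 15:28Z; never mirrored to the tree because g0 lacked crux-write — v5 is the first tree copy).
Cell `ns-blowup`, route `PalasekTowerBreakdown` rev 19: `EpisodeBaseT := EpisodeBaseGAt TowerRates.tuned`
(`TowerRates.tuned = (2^24, 33/32, 12/5, 49/20)`, `Re₀ = 2^{48/5} ≈ 776`, window 0 = `4bβ log N₁/A₀ ≈ 169.85/A₀`).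

## Shape (unchanged since v3/v4b; ONE registered stub)

* `mechanism_doorT : StrainDoor.MechanismDoorAt TowerRates.tuned` — CLOSED, cited BY NAME
  (`Theorems.palasekTowerBreakdown_mechanismDoorAt_tuned`, ecbridge-3 g9 p540639 ⇐ `Germ.mechanismDoorAt_of_boxNumerics`
  p537983 @ `TowerRates.tuned_boxNumerics`): ONE classical finite-energy FREE run (`ν = 1`) on `[1, τfirstAt tuned]` of a
  smooth compactly supported divergence-free datum of speed `< Y₀(tuned)`, under the cap `(5/3)Y₁ − η`, showing at
  `τfirstAt tuned` the speed `Y₁ + η`, the gradient `A₁ + η` and an `N₁`-core loop of circulation `≥ N₁^{β−2} + η`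
  ⟹ `EpisodeBaseGAt tuned`. (Was the registered stub `stub_mechanism_doorT` of v1–v3; discharged in v4.)
* `stub_raw_certificateT : StrainDoor.RawCertificateAt TowerRates.tuned` — OPEN, THE MECHANISM (registered stub; XL;
  a validated COMPUTATION in the RAW letter of `FluidComputer/PalasekTowerStrainDoorAtRaw.lean`, p531699): ONE explicit
  datum `U` (smooth, divergence free, `tsupport U ⊆ B̄(0,ρ)`, speed `< Y₀(tuned)`) + ONE explicit pair `(w, ψ)` on
  `[0, wfirstAt tuned]` forced by its own RAW residual `r := ∂ₜw + (w·∇)w + ∇ψ − Δw`, uniform Schwartz bounds, the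
  numerals (`‖r‖₂ ≤ G₂`, speed `≤ B_w`, compression majorant `Γ`, datum gaps `D`/`E₀`, `(24·9.03·(2B_w+1))²h ≤ 1`,
  `δ ≤ 1/2`, layer and window inequalities) and the four readouts with margins `η + δ` at the tuned numbers.
  KERNEL PRICE (p532337 `RawCertificateData.defect_budget_tuned`): `10^19·(E₀ + G₂·w₀)·e^{∫₀^{w₀}Γ} ≤ 1/4`.
  In host units (length `1/N₀`, speed `Y₀`, time `1/A₀`, `ν' = 1/776`): datum speed `< 1`; free run for `t' ∈ [0, 169.85]`;
  at `t' = 169.85`: speed `≥ 2.070`, finite-difference gradient `> 3.482`, loop radius `0.5946` with circulation `≥ 1.231`;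
  cap `≤ 3.450` for all `t'` (DESIGN-PRICE-MEMO-20303 §7, evidence #21). DIRECTOR-NS 11:36Z addendum: the witness datum
  must lie OUTSIDE the sterile axisymmetric-no-swirl class.
* `EpisodeBaseT_of` — the ONLY theorem concluding the route decl
  `Summit.NavierStokesRegularity.NavierStokesRegularity.Theses.PalasekTowerBreakdown.EpisodeBaseT` BY NAME, hypothesis-free,
  via `StrainDoor.episodeBaseGAt_of_mechanismDoorAt_of_rawCertificateAt` (p531699) — equivalently
  `Theorems.palasekTowerBreakdown_episodeBaseT_of_rawCertificateAt` (p540639).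

Alternative letters closing the same stub's content (all KERNEL, by name, `Theorems/…EpisodeBaseTMechanismFreeRun`):
`…_of_certificateAt` (classical letter, C₀ = oseenSliceConst), `…_of_certificateSharpAt` (numeral 9.03),
`…_of_certificateDataH2` (route (B), `H²`/Agmon), `…_of_mechanism_freeRun` / `…_of_curl_mechanism_freeRun` (binder forms);
route (A′) HYBRID letter = `StrainDoor.CertificateDataHybrid` (to be typed over fc-prover-2 g10's door
`StrainShadowHybrid.exists_freeRun_near_of_strainHybrid`, in flight). MODEL price of record (plan LETTER v3, STATUS l.9993):
a floor-passing design of laziness `s₅ = ∫Γ′` is certificate-affordable iff `s₅ ≤ Λ_a(road, arith)/c_road`,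
`c_road(A) = 1`, `c_road(A′) = 3` (L²-fed) / `2` (H¹-fed); bands 6.9 (A′ raw, double) … 87.9 (A, quad-double).

Disproof used: no `Cruxes/EpisodeBaseT/Disproof.lean` exists (checked 2026-08-27T16:2xZ). Honoured negatives (importable,
`Theorems/EpisodeBaseT/Negative/`): `CertificateSharpAtTunedPrice` (K208), `FreeRunLetterFalseOfSmallL3` (K210: the letter is
unsatisfiable from Kato-small `L³` data — the datum must be large in `L³`), `RawCertificateAtTunedDoubling` (K212: `D ≤ 1/4`, no steady
reference, sup-speed doubling inside 170 strain times), `CertificateH2ToleranceDominatesDatumSup` (K215). None bites the ∃-stub;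
all are design tests the computation must pass.

WHAT THIS IS NOT: not Navier–Stokes evidence — one `sorry` = one stub (the mechanism); no run, design or certificate is
exhibited; MODEL numbers are labelled MODEL.
-/

noncomputable section

-- `Summit.<Summit>.<Problem>` is the tree's mandated summit-side namespace (CONVENTIONS §2).
set_option linter.dupNamespace false

namespace Summit.NavierStokesRegularity.NavierStokesRegularity.Cruxes.EpisodeBaseT.StrainDoor

open Summit.NavierStokesRegularity.FluidComputer.PalasekTowerClayBridge
open Summit.NavierStokesRegularity.NavierStokesRegularity.Theorems

/-- The level-`1` mechanism door at `tuned` — CLOSED (ecbridge-3 g9, p540639/p537983), cited by name. Not a stub. -/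
theorem mechanism_doorT : StrainDoor.MechanismDoorAt TowerRates.tuned :=
  palasekTowerBreakdown_mechanismDoorAt_tuned

/-- **Registered stub (OPEN, the mechanism; XL computation)**: ONE RAW strain certificate at the tuned rates. -/
theorem stub_raw_certificateT : StrainDoor.RawCertificateAt TowerRates.tuned := by
  sorry

/-- **The skeleton — the ONLY theorem of this file concluding the route's crux `EpisodeBaseT` BY NAME** (hypothesis-free
composition; the `sorry` it carries is the stub's, decoration not closure evidence). -/
theorem EpisodeBaseT_of :
    Summit.NavierStokesRegularity.NavierStokesRegularity.Theses.PalasekTowerBreakdown.EpisodeBaseT :=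
  StrainDoor.episodeBaseGAt_of_mechanismDoorAt_of_rawCertificateAt mechanism_doorT stub_raw_certificateT

end Summit.NavierStokesRegularity.NavierStokesRegularity.Cruxes.EpisodeBaseT.StrainDoor

end
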